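import Mathlib
import Summits.MatrixMultiplication.MatrixMultiplication.Theses.MatrixPointInterpolation

/-!
# Crux `FewPointMasquerades` (stmt-MatrixMultiplication-18199) — LINE `twisted-trace`

Checked skeleton (crux-strategist `planner-cstrat-stmt-MatrixMultiplication-18199-0`, 2026-08-17).
The TWISTED-TRACE line (T) foreseen in the route header (TWO-LAYER PLAN), after the crux idea card
`Cruxes/LongMasquerade/Ideas/twisted-atoms.md` (crux-ideate on stmt-18938, whose SCOPE paragraph
assigns it to this successor crux).  Lever: a pair `A ∈ M_n(ℂ)²` generating `M_n` in degree `d`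
whose TRACE FUNCTIONAL on words of length `≤ 3d` is TWISTED ATOMIC of size `k` with `N` atoms,
`tr w(A) = Σ_{t<N} tr(M_t · w(B_t))` (`B_t ∈ M_k(ℂ)²` the points, `M_t ∈ M_k(ℂ)` the twists), is an
`N`-point masquerade on the window `2d`: pair `Σ_w c_w w(A)` against `v(A)`, `|v| ≤ d`, and use
`W_d(A) = M_n` with the non-degenerate trace form.  The unknowns of the crux drop from an `n × n` pair
plus `N` points to `3k²N` numbers (points and twists); `n²` re-emerges as the rank of the Hankel
matrix `[τ(uv)]_{|u|,|v| ≤ d}` of the functional.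

* `stub_twistedTraceMasquerades` — the open core: such pairs with `N ≤ n^(2+ε)`, `∀ ε ∃ k`.
* `stub_traceTransfer` — the transfer `C⁺ → C` at fixed data (M-sized linear algebra).
* `FewPointMasquerades_of` — kernel-checked composition (repackaging of quantifiers).
-/

set_option linter.dupNamespace false

namespace Summit.MatrixMultiplication.MatrixMultiplication.Cruxes.FewPointMasquerades.TwistedTrace

open scoped BigOperators
open Summit.MatrixMultiplication.MatrixMultiplication.Theses.MatrixPointInterpolation
  (FewPointMasquerades)

/-! ## Vocabulary -/

/-- `Gen n d A`: the words of length `≤ d` in the pair `A` span `M_n(ℂ)` (literally the generation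
conjunct of `FewPointMasquerades`). -/
def Gen (n d : ℕ) (A : Fin 2 → Matrix (Fin n) (Fin n) ℂ) : Prop :=
  Submodule.span ℂ {M : Matrix (Fin n) (Fin n) ℂ |
    ∃ w : List (Fin 2), w.length ≤ d ∧ (w.map A).prod = M} = ⊤

/-- `FewPoint n k d N A B`: evaluation at `A` on the window `2d` factors linearly through the `N`
points `B t ∈ M_k(ℂ)²` (literally the last conjunct of `FewPointMasquerades`). -/
def FewPoint (n k d N : ℕ) (A : Fin 2 → Matrix (Fin n) (Fin n) ℂ)
    (B : Fin N → Fin 2 → Matrix (Fin k) (Fin k) ℂ) : Prop :=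
  ∀ (T : Finset (List (Fin 2))) (c : List (Fin 2) → ℂ), (∀ w ∈ T, w.length ≤ 2 * d) →
    (∀ t : Fin N, (∑ w ∈ T, c w • (w.map (B t)).prod) = 0) → (∑ w ∈ T, c w • (w.map A).prod) = 0

/-- `TwistedAtomic n k D N A B M`: on words of length `≤ D` the trace functional of `A` is the
twisted atomic functional with points `B t` and twists `M t`:
`tr w(A) = Σ_t tr(M t · w(B t))`. -/
def TwistedAtomic (n k D N : ℕ) (A : Fin 2 → Matrix (Fin n) (Fin n) ℂ)
    (B : Fin N → Fin 2 → Matrix (Fin k) (Fin k) ℂ) (M : Fin N → Matrix (Fin k) (Fin k) ℂ) : Prop :=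
  ∀ w : List (Fin 2), w.length ≤ D →
    ((w.map A).prod).trace = ∑ t : Fin N, (M t * (w.map (B t)).prod).trace

/-- **TwistedTraceMasquerades** (statement of `stub_twistedTraceMasquerades`): for every `ε > 0`
a point size `k` such that for every `n₀` some pair `A ∈ M_n(ℂ)²`, `n ≥ n₀`, generates `M_n` in
degree `d` and has a twisted atomic trace functional of size `k` with `N ≤ n^(2+ε)` atoms on the
words of length `≤ 3d`. -/
def TwistedTraceMasquerades : Prop :=
  ∀ ε : ℝ, 0 < ε → ∃ k : ℕ, ∀ n₀ : ℕ, ∃ (n d N : ℕ) (A : Fin 2 → Matrix (Fin n) (Fin n) ℂ)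
    (B : Fin N → Fin 2 → Matrix (Fin k) (Fin k) ℂ) (M : Fin N → Matrix (Fin k) (Fin k) ℂ),
    n₀ ≤ n ∧ (N : ℝ) ≤ (n : ℝ) ^ ((2 : ℝ) + ε) ∧ Gen n d A ∧ TwistedAtomic n k (3 * d) N A B M

/-- **TraceTransfer** (statement of `stub_traceTransfer`): generation in degree `d` plus a twisted
atomic trace functional on the window `3d` give the few-point factorisation on the window `2d`
(through the same points). -/
def TraceTransfer : Prop :=
  ∀ (n k d N : ℕ) (A : Fin 2 → Matrix (Fin n) (Fin n) ℂ) (B : Fin N → Fin 2 → Matrix (Fin k) (Fin k) ℂ)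
    (M : Fin N → Matrix (Fin k) (Fin k) ℂ), Gen n d A → TwistedAtomic n k (3 * d) N A B M →
    FewPoint n k d N A B

/-! ## Registered stubs -/

/-- STUB (open core, XL).  Why plausibly true: it is implied by nothing weaker than the crux but is
the form in which witnesses are SEARCHABLE — for fixed points the admissible twists form the kernel of
a linear map (windowed traciality `Σ_t tr([M_t, u(B_t)] v(B_t)) = 0`, `|u|+|v| ≤ 3d`), honest atoms
(central twists) reproduce Kaplansky-bounded GNS quotients and are quotiented out, and exotic
solutions form their own components of the flat locus (card twisted-atoms, (2)–(3)).  Why it might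
fail: every non-central admissible twist at accessible `(k, N, d)` may have non-square or `≤ k²`
Hankel rank (the card's cheapest falsifier, one batched kit job, not yet run). -/
theorem stub_twistedTraceMasquerades : TwistedTraceMasquerades := by
  sorry

/-- STUB (M).  Proof on paper: put `X := Σ_{w∈T} c_w w(A)`; for `|v| ≤ d`,
`tr(X · v(A)) = Σ_w c_w tr((w ++ v)(A)) = Σ_t tr(M_t (Σ_w c_w w(B_t)) v(B_t)) = 0` since `|w ++ v| ≤ 3d`
and `(w ++ v).map = …` (`List.map_append`, `List.prod_append`); as `v(A)`, `|v| ≤ d`, span `M_n`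
(`Gen`) and the trace form is non-degenerate (`Matrix.trace_mul_comm`, test against
`Matrix.stdBasisMatrix`), `X = 0`. -/
theorem stub_traceTransfer : TraceTransfer := by
  sorry

/-! ## Composition -/

/-- **The line closes the crux.** `TwistedTraceMasquerades → TraceTransfer → FewPointMasquerades`. -/
theorem FewPointMasquerades_of (hT : TwistedTraceMasquerades) (hR : TraceTransfer) :
    FewPointMasquerades := by
  intro ε hε
  obtain ⟨k, hk⟩ := hT ε hε
  refine ⟨k, fun n₀ => ?_⟩
  obtain ⟨n, d, N, A, B, M, hn, hN, hgen, htw⟩ := hk n₀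
  exact ⟨n, d, N, A, B, hn, hN, hgen, hR n k d N A B M hgen htw⟩

/-- The crux from the two registered stubs (by name). -/
theorem FewPointMasquerades_of_stubs : FewPointMasquerades :=
  FewPointMasquerades_of stub_twistedTraceMasquerades stub_traceTransfer

end Summit.MatrixMultiplication.MatrixMultiplication.Cruxes.FewPointMasquerades.TwistedTrace
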